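import Literature.NumberTheory.EllipticCurves.PAdicOneVariableRelNormCoherentUnitsRayAction
import Literature.NumberTheory.GaloisRepresentations.LubinTateColemanCoordCoinvariantDivisionTwo
import Literature.NumberTheory.GaloisRepresentations.LubinTateColemanRelativeCoordGaloisTwo
import HarnessLib

/-!
# The Coleman coordinates of norm-coherent UNITS in the coordinate module: `Col(ββ′) = Col β + Col β′`, `Col(β^n) = C n • Col β`,
# `Col(σ̃·β) = σ_{χ_π(σ̃)}(Col β)` — so de Shalit's relation II §2.4 (ii) among units, `(g_𝔠·β_𝔞)·β_𝔠^{N𝔞} = (g_𝔞·β_𝔠)·β_𝔞^{N𝔠}`,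
# IS the module cocycle `σ_{v c}(x a) + N a • x c = σ_{v a}(x c) + N c • x a` of `LubinTateColemanCoordCoinvariantDivisionTwo`,
# and II §4.12 (`∃! L` with `φ_ε(Col β_c) = (t_{v c} − N c)·L`) holds for every such family — in particular under the `κ_v`-action `rayAction`

De Shalit, *Iwasawa theory of elliptic curves with complex multiplication* (1987), I §3.4 Lemma, §3.7; II §2.4 (ii), §4.12 (29)–(33);
III §1.4 (5).  The series-side §4.12 (`LubinTateColemanCoordCoinvariantDivisionTwo.existsUnique_colemanDeltaCoinvFun_eq_mul`) was stated
for an abstract family `x : I → M` in the Coleman coordinate module `M = 𝒪_E⟦Y⟧` over `Λ = 𝒪_E⟦T⟧` with an abstract cocycle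
hypothesis.  THIS file supplies the family and discharges the hypothesis from a relation among UNITS (0 sorry, no named facts):

* §1 `colemanCoordOfUnit hπ E hq hE hσ₀ u hu γ β := ofPS (r_β)` — **`Col(β) ∈ M`**, the Coleman coordinate `r_β` (`relUnitCoordTwo`, I §3.7) of
  `β ∈ 𝒰_𝔓 = RelNormCoherentUnits hπ E` as an element of the `Λ`-module; `toPS_colemanCoordOfUnit` (`rfl`);
  `colemanCoordOfUnit_mul` / `_one` / `_pow` (**`Col` is a homomorphism `𝒰_𝔓 → M`, `Col(β^n) = C n • Col β`**, from `relUnitCoordTwo_mul/_one`,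
  the termwise monoid structure `RelNormCoherentUnits.instCommMonoid` enabled section-locally) and ★ `colemanCoordOfUnit_galAct`
  (**`Col(σ̃·β) = σ_{χ_π(σ̃)}(Col β)`** for `σ̃` fixing `E` pointwise — `relUnitCoordTwo_galAct`, I §3.4 Lemma (ii), read through `unitTwistₗ_ofPS`);
* §2 ★★ `colemanCoordOfUnit_cocycle` — a relation **`(σ̃_c·β_a)·β_c^{n_a} = (σ̃_a·β_c)·β_a^{n_c}`** in `𝒰_𝔓` (the shape of the measure lane's
  `hrel`, II §2.4 (ii) for the elliptic units) gives the MODULE cocycle for `x c := Col(β c)`, `v c := χ_π(σ̃ c)`, `N c := C n_c`; hence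
  ★★ `existsUnique_colemanDeltaCoinvFun_colemanCoordOfUnit_eq_mul` (II §4.12 for units: with `χ_π(σ̃_{a₁}) = γ`, `n_{a₁} ≡ 1 (mod π)` and one
  index `a₂` with `(t_{v a₂} − n_{a₂})(n_{a₁} − 1) ≠ 0`, **`∃! L ∈ Λ` with `φ_ε(Col β_c) = (t_{χ_π(σ̃_c)} − n_c)·L` for every `c`**) and the
  concrete form `…_of_pow` of the auxiliary condition (`χ_π(σ̃_{a₂}) = γ^m`: `n_{a₁}^m ≠ n_{a₂}`);
* §3 the same under the `κ_v`-ACTION `rayAction h𝔪 hv hw hπ E hE` of `G = Gal(K̄/K(𝔪))` (`g • β = w_g·β`, `w_g` an inertia lift fixing `E ≤ K_v^{nr}`):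
  `colemanCoordOfUnit_rayAction_smul`, ★★ `colemanCoordOfUnit_cocycle_of_rayAction` (from `g_c • β_a * β_c ^ n_a = g_a • β_c * β_a ^ n_c` VERBATIM
  the shape of `hrel_ellipticUnitsLocal`), ★★ `existsUnique_colemanDeltaCoinvFun_colemanCoordOfUnit_eq_mul_of_rayAction`.

With `β_𝔞 := e(𝔞)_𝔓` (the measure lane's `ellipticUnitsLocal`, relation `hrel_ellipticUnitsLocal`) the `L` of §3 is de Shalit's `μ(𝔣)` on the
`ε`-part at one prime AS A POWER SERIES in `Λ = 𝒪_E⟦T⟧`; `φ_ε(Λ·Col 𝒞) = L·J_ε` and the characteristic-ideal identity are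
`colemanDeltaCoinvFun_map_span_range_eq_span_mul_of_forall` and `Summit…PrintCf2RubinValueTwoColemanCoinvariantCharSeries`.
Cell `bsd-print-cf2`, width seat `bsd-line-cf2c-w7` g13.

## References
* E. de Shalit, *Iwasawa theory of elliptic curves with complex multiplication* (1987), Ch. I §3.4 Lemma (i)–(ii), §3.7; Ch. II §2.4 (ii),
  §4.5 (p. 58), §4.12 (29)–(33); Ch. III §1.4 (5). [deShalit1987]
-/

noncomputable section

namespace Literature.NumberTheory.EllipticCurves

section CocycleOfUnitsLocal

open ValuativeRel IsLocalRing Field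
open Literature.NumberTheory.GaloisRepresentations Literature.NumberTheory.GaloisRepresentations.IsNonarchimedeanLocalField
  Literature.NumberTheory.GaloisRepresentations.LubinTate

variable {F : Type} [Field F] [ValuativeRel F] [TopologicalSpace F] [IsNonarchimedeanLocalField F]

attribute [local instance] ltNormUniformSpace ltNormIsUniformAddGroup rk1 nF nE fintypeResidueField
attribute [local instance] RelNormCoherentUnits.instCommMonoid

variable {π : 𝒪[F]} (hπ : (valuation F).IsUniformizer (π : F))
variable (E : IntermediateField F (AlgebraicClosure F)) [FiniteDimensional F E] [Normal F E] [IsGalois F E]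
variable (hq : residueFieldCard F = 2) (hE : E ≤ maxUnramified F) {σ₀ : absoluteGaloisGroup F} (hσ₀ : IsAbsArithFrob σ₀)
variable (u : (LTCoeff F)ˣ) (hu : LTCoeff.of F π = residueFieldCard F * u) (γ : 𝒪[F]ˣ)

/-! ### §1. `Col : 𝒰_𝔓 → M` is a homomorphism intertwining `σ̃` with `σ_{χ_π(σ̃)}` -/

/-- **`Col(β) ∈ M`**: the Coleman coordinate `r_β ∈ 𝒪_E⟦Y⟧` of the norm-coherent unit `β` ((δβ)~ = (1 + u⁻¹X)(r_β ∘ f)`, I §3.7) as an element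
of the coordinate module `M` over `Λ = 𝒪_E⟦T⟧` (`T` acting as `σ_γ − 1`). [cite: deShalit1987, Ch. I §3.7; Ch. II §4.7] -/
def colemanCoordOfUnit (β : RelNormCoherentUnits hπ E) :
    ColemanCoordModule hπ hq (algebraMap (LTCoeff F) (unitBall E)) u hu γ :=
  TActModule.ofPS _ _ (relUnitCoordTwo hπ E hq hE hσ₀ u hu β)

/-- Unfolding: the underlying series of `Col(β)` is `r_β`. [cite: deShalit1987, Ch. I §3.7] -/
@[simp] theorem toPS_colemanCoordOfUnit (β : RelNormCoherentUnits hπ E) :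
    TActModule.toPS (colemanCoordOfUnit hπ E hq hE hσ₀ u hu γ β) = relUnitCoordTwo hπ E hq hE hσ₀ u hu β := rfl

/-- **`Col(ββ′) = Col β + Col β′`.** [cite: deShalit1987, Ch. I §3.4 Lemma (i), §3.7] -/
theorem colemanCoordOfUnit_mul (β β' : RelNormCoherentUnits hπ E) :
    colemanCoordOfUnit hπ E hq hE hσ₀ u hu γ (β * β') =
      colemanCoordOfUnit hπ E hq hE hσ₀ u hu γ β + colemanCoordOfUnit hπ E hq hE hσ₀ u hu γ β' := by
  change TActModule.ofPS _ _ (relUnitCoordTwo hπ E hq hE hσ₀ u hu (β.mul β')) = _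
  rw [relUnitCoordTwo_mul, map_add]
  rfl

/-- **`Col(1) = 0`.** [cite: deShalit1987, Ch. I §3.4 Lemma (i)] -/
theorem colemanCoordOfUnit_one :
    colemanCoordOfUnit hπ E hq hE hσ₀ u hu γ (1 : RelNormCoherentUnits hπ E) = 0 := by
  change TActModule.ofPS _ _ (relUnitCoordTwo hπ E hq hE hσ₀ u hu (RelNormCoherentUnits.one : RelNormCoherentUnits hπ E)) = 0
  rw [relUnitCoordTwo_one, map_zero]

variable [IsAdicComplete (Ideal.span {algebraMap (LTCoeff F) (unitBall E) (LTCoeff.of F π)}) (unitBall E)]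

/-- **`Col(β^n) = C n • Col β`** (the integer `n` as the constant `C n ∈ Λ`). [cite: deShalit1987, Ch. I §3.4 Lemma (i), §3.7] -/
theorem colemanCoordOfUnit_pow (β : RelNormCoherentUnits hπ E) (n : ℕ) :
    colemanCoordOfUnit hπ E hq hE hσ₀ u hu γ (β ^ n) =
      (PowerSeries.C ((n : ℕ) : unitBall E) : PowerSeries (unitBall E)) • colemanCoordOfUnit hπ E hq hE hσ₀ u hu γ β := by
  induction n with
  | zero => rw [pow_zero, colemanCoordOfUnit_one, Nat.cast_zero, map_zero, zero_smul]
  | succ n ih => rw [pow_succ, colemanCoordOfUnit_mul, ih, Nat.cast_succ, map_add, map_one, add_smul, one_smul]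

/-- `Col(β^n) = n • Col β`. [cite: deShalit1987, Ch. I §3.4 Lemma (i)] -/
theorem colemanCoordOfUnit_pow_eq_nsmul (β : RelNormCoherentUnits hπ E) (n : ℕ) :
    colemanCoordOfUnit hπ E hq hE hσ₀ u hu γ (β ^ n) = n • colemanCoordOfUnit hπ E hq hE hσ₀ u hu γ β := by
  rw [colemanCoordOfUnit_pow, map_natCast, Nat.cast_smul_eq_nsmul]

/-- ★ **`Col(σ̃·β) = σ_{χ_π(σ̃)}(Col β)`** for `σ̃ ∈ Γ_F` fixing `E` pointwise: `β ↦ Col β` intertwines the Galois action on `𝒰_𝔓` with the unit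
twists `σ_v = 1 + D_v` of the coordinate module (`r_{σ̃β} = r_β + D_{χ_π(σ̃)} r_β`). [cite: deShalit1987, Ch. I §3.4 Lemma (ii), §3.7] -/
theorem colemanCoordOfUnit_galAct (β : RelNormCoherentUnits hπ E) {σ : absoluteGaloisGroup F}
    (hσE : ∀ x : E, σ • (x : AlgebraicClosure F) = x) :
    colemanCoordOfUnit hπ E hq hE hσ₀ u hu γ (β.galAct σ) =
      unitTwistₗ hπ hq (algebraMap (LTCoeff F) (unitBall E)) u hu γ (lubinTateChar hπ σ)
        (colemanCoordOfUnit hπ E hq hE hσ₀ u hu γ β) := by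
  apply TActModule.toPS_injective
  rw [toPS_unitTwistₗ, toPS_colemanCoordOfUnit, toPS_colemanCoordOfUnit, relUnitCoordTwo_galAct hπ E hq hE hσ₀ u hu β hσE,
    twistLinearBase_apply, sub_add_cancel]
  rfl

/-! ### §2. The unit relation II §2.4 (ii) gives the module cocycle, hence II §4.12 for units -/

/-- ★★ **The relation among units IS the module cocycle**: if `(σ̃_c·β_a)·β_c^{n_a} = (σ̃_a·β_c)·β_a^{n_c}` in `𝒰_𝔓` for all `a`, `c` (the `σ̃_i`
fixing `E` pointwise), then `x c := Col(β c)` satisfies **`σ_{χ_π(σ̃_c)}(x a) + C n_a • x c = σ_{χ_π(σ̃_a)}(x c) + C n_c • x a`** — the hypothesis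
`hrel` of `existsUnique_colemanDeltaCoinvFun_eq_mul`. [cite: deShalit1987, Ch. II §2.4 (ii), §4.12 (29); Ch. I §3.4 Lemma] -/
theorem colemanCoordOfUnit_cocycle {I : Type*} (β : I → RelNormCoherentUnits hπ E) (σ : I → absoluteGaloisGroup F)
    (hσE : ∀ (i : I) (x : E), σ i • (x : AlgebraicClosure F) = x) (n : I → ℕ)
    (hrel : ∀ a c : I, (β a).galAct (σ c) * β c ^ n a = (β c).galAct (σ a) * β a ^ n c) (a c : I) :
    unitTwistₗ hπ hq (algebraMap (LTCoeff F) (unitBall E)) u hu γ (lubinTateChar hπ (σ c))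
        (colemanCoordOfUnit hπ E hq hE hσ₀ u hu γ (β a)) +
      (PowerSeries.C ((n a : ℕ) : unitBall E) : PowerSeries (unitBall E)) • colemanCoordOfUnit hπ E hq hE hσ₀ u hu γ (β c) =
    unitTwistₗ hπ hq (algebraMap (LTCoeff F) (unitBall E)) u hu γ (lubinTateChar hπ (σ a))
        (colemanCoordOfUnit hπ E hq hE hσ₀ u hu γ (β c)) +
      (PowerSeries.C ((n c : ℕ) : unitBall E) : PowerSeries (unitBall E)) • colemanCoordOfUnit hπ E hq hE hσ₀ u hu γ (β a) := by
  have h := congrArg (colemanCoordOfUnit hπ E hq hE hσ₀ u hu γ) (hrel a c)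
  rwa [colemanCoordOfUnit_mul, colemanCoordOfUnit_mul, colemanCoordOfUnit_galAct hπ E hq hE hσ₀ u hu γ _ (hσE c),
    colemanCoordOfUnit_galAct hπ E hq hE hσ₀ u hu γ _ (hσE a), colemanCoordOfUnit_pow, colemanCoordOfUnit_pow] at h

variable (hreg : ∀ x : unitBall E, algebraMap (LTCoeff F) (unitBall E) (LTCoeff.of F π) * x = 0 → x = 0)
  (w : 𝒪[F]ˣ) (hγ : (γ : 𝒪[F]) = 1 + π ^ 2 * w) (ε : PowerSeries (unitBall E)) (hε : ε * ε = 1)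

include hε in
/-- ★★ **DE SHALIT II §4.12 FOR A FAMILY OF UNITS** (`ε`-part, one prime, `q = 2`): under the unit relation of `colemanCoordOfUnit_cocycle`, an index
`a₁` with `χ_π(σ̃_{a₁}) = γ` (the module generator) and `n_{a₁} ≡ 1 (mod π)`, and an index `a₂` with `(t_{χ_π(σ̃_{a₂})} − n_{a₂})(n_{a₁} − 1) ≠ 0`,
**there is a UNIQUE `L ∈ Λ = 𝒪_E⟦T⟧` with `φ_ε(Col β_c) = (t_{χ_π(σ̃_c)} − n_c)·L` for every `c`** (`t_v = φ_ε(σ_v 1)`; `L` = de Shalit's `μ(𝔣)`, `ε`-part, as a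
series). [cite: deShalit1987, Ch. II §4.12 (29)–(33); Ch. III §1.4 (5)] -/
theorem existsUnique_colemanDeltaCoinvFun_colemanCoordOfUnit_eq_mul {I : Type*} (β : I → RelNormCoherentUnits hπ E)
    (σ : I → absoluteGaloisGroup F) (hσE : ∀ (i : I) (x : E), σ i • (x : AlgebraicClosure F) = x) (n : I → ℕ)
    (hrel : ∀ a c : I, (β a).galAct (σ c) * β c ^ n a = (β c).galAct (σ a) * β a ^ n c) (a₁ a₂ : I)
    (hv₁ : lubinTateChar hπ (σ a₁) = γ)
    (hn₁ : ((n a₁ : ℕ) : unitBall E) - 1 ∈ Ideal.span {algebraMap (LTCoeff F) (unitBall E) (LTCoeff.of F π)})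
    (ha₂ : tEval hn₁ (colemanDeltaCoinvFun hπ hq (algebraMap (LTCoeff F) (unitBall E)) u hu γ hreg w hγ ε
        (unitTwistₗ hπ hq (algebraMap (LTCoeff F) (unitBall E)) u hu γ (lubinTateChar hπ (σ a₂)) (TActModule.ofPS _ _ 1)) -
          PowerSeries.C ((n a₂ : ℕ) : unitBall E)) ≠ 0) :
    ∃! L : PowerSeries (unitBall E), ∀ c : I,
      colemanDeltaCoinvFun hπ hq (algebraMap (LTCoeff F) (unitBall E)) u hu γ hreg w hγ ε (colemanCoordOfUnit hπ E hq hE hσ₀ u hu γ (β c)) =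
        (colemanDeltaCoinvFun hπ hq (algebraMap (LTCoeff F) (unitBall E)) u hu γ hreg w hγ ε
            (unitTwistₗ hπ hq (algebraMap (LTCoeff F) (unitBall E)) u hu γ (lubinTateChar hπ (σ c)) (TActModule.ofPS _ _ 1)) -
          PowerSeries.C ((n c : ℕ) : unitBall E)) * L :=
  existsUnique_colemanDeltaCoinvFun_eq_mul_of_ne_zero hπ hq (algebraMap (LTCoeff F) (unitBall E)) u hu γ hreg w hγ ε hε
    (fun c => colemanCoordOfUnit hπ E hq hE hσ₀ u hu γ (β c)) (fun c => lubinTateChar hπ (σ c))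
    (fun c => PowerSeries.C ((n c : ℕ) : unitBall E)) (colemanCoordOfUnit_cocycle hπ E hq hE hσ₀ u hu γ β σ hσE n hrel)
    a₁ a₂ hv₁ rfl hn₁ ha₂

include hε in
/-- **Concrete auxiliary condition**: if moreover `χ_π(σ̃_{a₂}) = γ^m`, the condition at `a₂` reads `n_{a₁}^m ≠ n_{a₂}` in `𝒪_E`
(`(t_{γ^m} − n₂)(n₁ − 1) = n₁^m − n₂`). [cite: deShalit1987, Ch. II §4.12 (29)–(33)] -/
theorem existsUnique_colemanDeltaCoinvFun_colemanCoordOfUnit_eq_mul_of_pow {I : Type*} (β : I → RelNormCoherentUnits hπ E)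
    (σ : I → absoluteGaloisGroup F) (hσE : ∀ (i : I) (x : E), σ i • (x : AlgebraicClosure F) = x) (n : I → ℕ)
    (hrel : ∀ a c : I, (β a).galAct (σ c) * β c ^ n a = (β c).galAct (σ a) * β a ^ n c) (a₁ a₂ : I)
    (hv₁ : lubinTateChar hπ (σ a₁) = γ)
    (hn₁ : ((n a₁ : ℕ) : unitBall E) - 1 ∈ Ideal.span {algebraMap (LTCoeff F) (unitBall E) (LTCoeff.of F π)})
    {m : ℕ} (hv₂ : lubinTateChar hπ (σ a₂) = γ ^ m) (hne : ((n a₁ : ℕ) : unitBall E) ^ m ≠ ((n a₂ : ℕ) : unitBall E)) :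
    ∃! L : PowerSeries (unitBall E), ∀ c : I,
      colemanDeltaCoinvFun hπ hq (algebraMap (LTCoeff F) (unitBall E)) u hu γ hreg w hγ ε (colemanCoordOfUnit hπ E hq hE hσ₀ u hu γ (β c)) =
        (colemanDeltaCoinvFun hπ hq (algebraMap (LTCoeff F) (unitBall E)) u hu γ hreg w hγ ε
            (unitTwistₗ hπ hq (algebraMap (LTCoeff F) (unitBall E)) u hu γ (lubinTateChar hπ (σ c)) (TActModule.ofPS _ _ 1)) -
          PowerSeries.C ((n c : ℕ) : unitBall E)) * L := by
  refine existsUnique_colemanDeltaCoinvFun_colemanCoordOfUnit_eq_mul hπ E hq hE hσ₀ u hu γ hreg w hγ ε hε β σ hσE n hrel a₁ a₂ hv₁ hn₁ ?_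
  rw [hv₂, tEval_colemanDeltaCoinvFun_unitTwistₗ_pow_one_sub_C_sub_one]
  exact sub_ne_zero.mpr hne

end CocycleOfUnitsLocal

/-! ### §3. Under the `κ_v`-action of `G = Gal(K̄/K(𝔪))` on `𝒰_𝔓` -/

section CocycleOfUnitsRay

open NumberField IsDedekindDomain IsDedekindDomain.HeightOneSpectrum Field ValuativeRel IsLocalRing
open Literature.NumberTheory.GaloisRepresentations Literature.NumberTheory.GaloisRepresentations.IsNonarchimedeanLocalField
  Literature.NumberTheory.GaloisRepresentations.LubinTate Literature.NumberTheory.NumberFields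

variable {K : Type} [Field K] [NumberField K] [IsTotallyComplex K] {𝔪 : Ideal (𝓞 K)} {v : HeightOneSpectrum (𝓞 K)}
  (h𝔪 : 𝔪 ≠ ⊥) (hv : ¬ 𝔪 ≤ v.asIdeal) (hw : ∀ u : (𝓞 K)ˣ, (u : 𝓞 K) - 1 ∈ 𝔪 → u = 1)

attribute [local instance] ltNormUniformSpace ltNormIsUniformAddGroup rk1 nF nE fintypeResidueField
attribute [local instance] RelNormCoherentUnits.instCommMonoid

variable {π : 𝒪[v.adicCompletion K]} (hπ : (valuation (v.adicCompletion K)).IsUniformizer (π : v.adicCompletion K))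
variable (E : IntermediateField (v.adicCompletion K) (AlgebraicClosure (v.adicCompletion K)))
  [FiniteDimensional (v.adicCompletion K) E] [Normal (v.adicCompletion K) E] [IsGalois (v.adicCompletion K) E]
  (hq : residueFieldCard (v.adicCompletion K) = 2) (hE : E ≤ maxUnramified (v.adicCompletion K))
  {σ₀ : absoluteGaloisGroup (v.adicCompletion K)} (hσ₀ : IsAbsArithFrob σ₀)
  (u : (LTCoeff (v.adicCompletion K))ˣ) (hu : LTCoeff.of (v.adicCompletion K) π = residueFieldCard (v.adicCompletion K) * u)
  (γ : 𝒪[v.adicCompletion K]ˣ)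
variable [IsAdicComplete (Ideal.span {algebraMap (LTCoeff (v.adicCompletion K)) (unitBall E) (LTCoeff.of (v.adicCompletion K) π)})
  (unitBall E)]

/-- **`Col(g • β) = σ_{χ_π(w_g)}(Col β)`** for the `κ_v`-action (`g • β = w_g·β`, `w_g` an inertia lift, fixing `E ≤ K_v^{nr}`).
[cite: deShalit1987, Ch. II §4.5 (p. 58); Ch. I §3.4 Lemma (ii)] -/
theorem colemanCoordOfUnit_rayAction_smul (g : ↥(absRestrictNormalHom (rayClassField K 𝔪)).ker) (β : RelNormCoherentUnits hπ E) :
    letI := rayAction h𝔪 hv hw hπ E hE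
    colemanCoordOfUnit hπ E hq hE hσ₀ u hu γ (g • β) =
      unitTwistₗ hπ hq (algebraMap (LTCoeff (v.adicCompletion K)) (unitBall E)) u hu γ
        (lubinTateChar hπ (WeilGroup.toAbsGalois (v.adicCompletion K) (rayInertiaLift h𝔪 hv hw g)))
        (colemanCoordOfUnit hπ E hq hE hσ₀ u hu γ β) :=
  colemanCoordOfUnit_galAct hπ E hq hE hσ₀ u hu γ β (smul_coe_eq_of_mem_inertia v (rayInertiaLift_mem_inertia h𝔪 hv hw g) hE)

/-- ★★ **The `hrel` of the measure lane gives the module cocycle**: from `g_c • β_a * β_c ^ n_a = g_a • β_c * β_a ^ n_c` in `𝒰_𝔓` with the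
`κ_v`-action (VERBATIM the shape of `hrel_ellipticUnitsLocal`, II §2.4 (ii)), `x c := Col(β c)` satisfies
`σ_{v c}(x a) + C n_a • x c = σ_{v a}(x c) + C n_c • x a` with `v c := χ_π(w_{g_c})`. [cite: deShalit1987, Ch. II §2.4 (ii), §4.5, §4.12 (29)] -/
theorem colemanCoordOfUnit_cocycle_of_rayAction {I : Type*} (β : I → RelNormCoherentUnits hπ E)
    (g : I → ↥(absRestrictNormalHom (rayClassField K 𝔪)).ker) (n : I → ℕ)
    (hrel : letI := rayAction h𝔪 hv hw hπ E hE
      ∀ a c : I, g c • β a * β c ^ n a = g a • β c * β a ^ n c) (a c : I) :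
    unitTwistₗ hπ hq (algebraMap (LTCoeff (v.adicCompletion K)) (unitBall E)) u hu γ
        (lubinTateChar hπ (WeilGroup.toAbsGalois (v.adicCompletion K) (rayInertiaLift h𝔪 hv hw (g c))))
        (colemanCoordOfUnit hπ E hq hE hσ₀ u hu γ (β a)) +
      (PowerSeries.C ((n a : ℕ) : unitBall E) : PowerSeries (unitBall E)) • colemanCoordOfUnit hπ E hq hE hσ₀ u hu γ (β c) =
    unitTwistₗ hπ hq (algebraMap (LTCoeff (v.adicCompletion K)) (unitBall E)) u hu γ
        (lubinTateChar hπ (WeilGroup.toAbsGalois (v.adicCompletion K) (rayInertiaLift h𝔪 hv hw (g a))))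
        (colemanCoordOfUnit hπ E hq hE hσ₀ u hu γ (β c)) +
      (PowerSeries.C ((n c : ℕ) : unitBall E) : PowerSeries (unitBall E)) • colemanCoordOfUnit hπ E hq hE hσ₀ u hu γ (β a) :=
  colemanCoordOfUnit_cocycle hπ E hq hE hσ₀ u hu γ β
    (fun i => WeilGroup.toAbsGalois (v.adicCompletion K) (rayInertiaLift h𝔪 hv hw (g i)))
    (fun i => smul_coe_eq_of_mem_inertia v (rayInertiaLift_mem_inertia h𝔪 hv hw (g i)) hE) n hrel a c

variable (hreg : ∀ x : unitBall E, algebraMap (LTCoeff (v.adicCompletion K)) (unitBall E) (LTCoeff.of (v.adicCompletion K) π) * x = 0 → x = 0)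
  (w : 𝒪[v.adicCompletion K]ˣ) (hγ : (γ : 𝒪[v.adicCompletion K]) = 1 + π ^ 2 * w) (ε : PowerSeries (unitBall E)) (hε : ε * ε = 1)

include hε in
/-- ★★ **DE SHALIT II §4.12 for units under the `κ_v`-action**: `g_c • β_a * β_c ^ n_a = g_a • β_c * β_a ^ n_c`, `χ_π(w_{g_{a₁}}) = γ`,
`n_{a₁} ≡ 1 (mod π)`, `χ_π(w_{g_{a₂}}) = γ^m` with `n_{a₁}^m ≠ n_{a₂}` ⟹ **`∃! L ∈ Λ`, `φ_ε(Col β_c) = (t_{χ_π(w_{g_c})} − n_c)·L` for every `c`.**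
[cite: deShalit1987, Ch. II §4.12 (29)–(33); Ch. III §1.4 (5)] -/
theorem existsUnique_colemanDeltaCoinvFun_colemanCoordOfUnit_eq_mul_of_rayAction {I : Type*} (β : I → RelNormCoherentUnits hπ E)
    (g : I → ↥(absRestrictNormalHom (rayClassField K 𝔪)).ker) (n : I → ℕ)
    (hrel : letI := rayAction h𝔪 hv hw hπ E hE
      ∀ a c : I, g c • β a * β c ^ n a = g a • β c * β a ^ n c) (a₁ a₂ : I)
    (hv₁ : lubinTateChar hπ (WeilGroup.toAbsGalois (v.adicCompletion K) (rayInertiaLift h𝔪 hv hw (g a₁))) = γ)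
    (hn₁ : ((n a₁ : ℕ) : unitBall E) - 1 ∈
      Ideal.span {algebraMap (LTCoeff (v.adicCompletion K)) (unitBall E) (LTCoeff.of (v.adicCompletion K) π)})
    {m : ℕ} (hv₂ : lubinTateChar hπ (WeilGroup.toAbsGalois (v.adicCompletion K) (rayInertiaLift h𝔪 hv hw (g a₂))) = γ ^ m)
    (hne : ((n a₁ : ℕ) : unitBall E) ^ m ≠ ((n a₂ : ℕ) : unitBall E)) :
    ∃! L : PowerSeries (unitBall E), ∀ c : I,
      colemanDeltaCoinvFun hπ hq (algebraMap (LTCoeff (v.adicCompletion K)) (unitBall E)) u hu γ hreg w hγ ε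
          (colemanCoordOfUnit hπ E hq hE hσ₀ u hu γ (β c)) =
        (colemanDeltaCoinvFun hπ hq (algebraMap (LTCoeff (v.adicCompletion K)) (unitBall E)) u hu γ hreg w hγ ε
            (unitTwistₗ hπ hq (algebraMap (LTCoeff (v.adicCompletion K)) (unitBall E)) u hu γ
              (lubinTateChar hπ (WeilGroup.toAbsGalois (v.adicCompletion K) (rayInertiaLift h𝔪 hv hw (g c)))) (TActModule.ofPS _ _ 1)) -
          PowerSeries.C ((n c : ℕ) : unitBall E)) * L :=
  existsUnique_colemanDeltaCoinvFun_colemanCoordOfUnit_eq_mul_of_pow hπ E hq hE hσ₀ u hu γ hreg w hγ ε hε β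
    (fun i => WeilGroup.toAbsGalois (v.adicCompletion K) (rayInertiaLift h𝔪 hv hw (g i)))
    (fun i => smul_coe_eq_of_mem_inertia v (rayInertiaLift_mem_inertia h𝔪 hv hw (g i)) hE) n hrel a₁ a₂ hv₁ hn₁ hv₂ hne

end CocycleOfUnitsRay

end Literature.NumberTheory.EllipticCurves
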